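import Summits.QuantumFields.YangMills.Theorems.CurvatureBoostCovariance.Negative.Unbundled
import Summits.QuantumFields.YangMills.Theorems.NPointIsotropy.Negative.NPointRegularJunk
import Summits.QuantumFields.YangMills.Theorems.PencilRigidityNPointIsotropyMopupHelpers
import Summits.QuantumFields.YangMills.Theorems.MirrorModularBoostsCurvatureBoostCovarianceTensorDensity
import Literature.MathematicalPhysics.QuantumFieldTheory.OSLorentzInvariance

/-!
# The a.e. upgrade of the planar band limit under the function residual — stub `stub_orbitGenericUpgrade`

Line `boosts-inherit-mirrors` of crux `MirrorModularBoosts.CurvatureBoostCovariance`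
(stmt-QuantumFields-9663), Stub 3b of the registered skeleton
`Cruxes/CurvatureBoostCovariance/Lines/boosts_inherit_mirrors.lean` (one of the four proved pieces of
Stub 3, `stub_orbitBandlimit`: the orbit function `θ ↦ 𝔖_N(R_θ · H)`, `R_θ = planeRot 0 θ` the rotation of
the `(x₀,x₁)`-plane of `ℝ⁴`, of a doubled test function is a trigonometric polynomial).

Statement (`stub_orbitGenericUpgrade`).  Let `T` be a degree-`N` functional that on `⁰𝒮_N` (off-diagonal test
functions) is integration against a FUNCTION `W` (`W·F` integrable, `T F = ∫ W F`), and `G` an open conull set of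
configurations avoiding the coincidence locus such that the orbit function `θ ↦ T (R_θ · F)` of every compactly
supported `F` supported in `G` is a trigonometric polynomial `∑_{|k| ≤ K} c_k e^{4ikθ}` of degree `≤ K` (the SAME
`K` for all such `F`).  Then the same holds for every `F ∈ ⁰𝒮_N`.

Proof (`OrbitBandlimit.trigPoly_of_generic`).  For fixed `θ` and off-diagonal `F'`,
`T (R_θ · F') = ∫ (W ∘ R_θ) · F'` with an integrable integrand (Lebesgue measure on `(ℝ⁴)^N` is invariant under
the diagonal action, landed `Mopup.measurePreserving_diag` / `Mopup.integral_mul_linActMulti`).  Let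
`C_j = B̄(0,j) ∩ {x | dist(x,y) ≥ 1/(j+1) ∀ y ∉ G}`, a compact exhaustion of `G` (every point of the open `G` lies
in `C_j` for all large `j`), and `χ_j ∈ [0,1]` smooth cut-offs with `χ_j = 1` on `C_j` and compact support
inside `G` (landed `exists_smooth_cutoff` of the sibling `…TensorDensity.lean`).  The truncations `χ_j F` are
Schwartz, compactly supported in `G`, hence off-diagonal; dominated convergence (`|χ_j| ≤ 1`, bound
`|W∘R_θ| |F|`, `χ_j → 1_G` pointwise, `Gᶜ` null) gives `T (R_θ · χ_j F) → T (R_θ · F)` angle by angle; and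
trigonometric polynomials of degree `≤ K` are closed under pointwise limits (`OrbitBandlimit.trigPoly_of_tendsto`:
a finite-dimensional subspace of `ℝ → ℂ` is closed in the product topology).  Without the uniform degree the
statement fails (pointwise limits of trigonometric polynomials of unbounded degree are arbitrary); without the
function residual it fails too (the junk family of `Negative/PlanarGenericJunk.lean` charges the null set `Gᶜ`).

Public helper (sub-namespace `OrbitBandlimit`, reused by the sibling file of `stub_orbitBandlimit`):
`trigPoly_of_tendsto`.  (The algebraic generic set the sibling files feed into `G` is the landed
`Mopup.exists_generic_set` of `Theorems/PencilRigidityNPointIsotropyMopup.lean`, sibling crux stmt-QuantumFields-11686;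
nothing of that file is re-proved here.)

References: the a.e. mop-up pattern is the landed `PencilRigidityNPointIsotropyMopup.lean`; K. Osterwalder,
R. Schrader, Comm. Math. Phys. 31 (1973) §4 (change of variables under Euclidean motions); dominated convergence and
`Submodule.closed_of_finiteDimensional` are Mathlib's.
-/

noncomputable section

-- tree-known workaround (kept in every landed `Negative/*.lean` file):
attribute [-instance] SimplexCategory.instFintypeToTypeOrderHomFinHAddNatLenOfNat

namespace Summit.QuantumFields.YangMills.Theorems.CurvatureBoostCovariance.BoostsInheritMirrors

open scoped BigOperators SchwartzMap
open MeasureTheory Filter Topology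
open Literature.MathematicalPhysics.QuantumLattice Literature.MathematicalPhysics.AQFT
  Literature.MathematicalPhysics.QuantumFieldTheory
open Summit.QuantumFields.YangMills.Theorems.NPointIsotropy.Negative (E4)
open Summit.QuantumFields.YangMills.Theorems.CurvatureBoostCovariance.Negative (isOffDiagonal_linActMulti)
open Summit.QuantumFields.YangMills.Theorems.NPointIsotropy.ComplexRotationBandlimit.Mopup
  (measurePreserving_diag integral_mul_linActMulti)

namespace OrbitBandlimit

variable {N : ℕ}

/-! ## Trigonometric polynomials of degree `≤ K` are closed under pointwise limits -/

/-- **Trigonometric polynomials of degree `≤ K` are closed under pointwise limits** (they form a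
finite-dimensional, hence closed, subspace of `ℝ → ℂ` in the topology of pointwise convergence). -/
theorem trigPoly_of_tendsto (K : ℕ) {p : ℕ → ℝ → ℂ} {g : ℝ → ℂ}
    (hp : ∀ j, ∃ c : ℤ → ℂ, ∀ θ : ℝ,
      p j θ = ∑ k ∈ Finset.Icc (-(K : ℤ)) K, c k * Complex.exp (4 * (k : ℂ) * (θ : ℂ) * Complex.I))
    (hlim : ∀ θ : ℝ, Tendsto (fun j => p j θ) atTop (𝓝 (g θ))) :
    ∃ c : ℤ → ℂ, ∀ θ : ℝ,
      g θ = ∑ k ∈ Finset.Icc (-(K : ℤ)) K, c k * Complex.exp (4 * (k : ℂ) * (θ : ℂ) * Complex.I) := by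
  -- the exponentials `e_k`, `|k| ≤ K`, and their span
  set e : Finset.Icc (-(K : ℤ)) K → (ℝ → ℂ) := fun k θ =>
    Complex.exp (4 * ((k : ℤ) : ℂ) * (θ : ℂ) * Complex.I) with he
  set P : Submodule ℂ (ℝ → ℂ) := Submodule.span ℂ (Set.range e) with hP
  haveI hPfd : FiniteDimensional ℂ P := FiniteDimensional.span_of_finite ℂ (Set.finite_range e)
  have hPclosed : IsClosed (P : Set (ℝ → ℂ)) := P.closed_of_finiteDimensional
  have hmem : ∀ q : ℝ → ℂ, q ∈ P ↔ ∃ c : ℤ → ℂ, ∀ θ : ℝ,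
      q θ = ∑ k ∈ Finset.Icc (-(K : ℤ)) K, c k * Complex.exp (4 * (k : ℂ) * (θ : ℂ) * Complex.I) := by
    intro q
    rw [hP, Submodule.mem_span_range_iff_exists_fun]
    constructor
    · rintro ⟨c, hc⟩
      classical
      refine ⟨fun k => if hk : k ∈ Finset.Icc (-(K : ℤ)) K then c ⟨k, hk⟩ else 0, fun θ => ?_⟩
      have hθ := congr_fun hc θ
      simp only [Finset.sum_apply, Pi.smul_apply, smul_eq_mul] at hθ
      rw [← hθ, ← Finset.sum_coe_sort (Finset.Icc (-(K : ℤ)) K)]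
      refine Finset.sum_congr rfl fun k _ => ?_
      dsimp only
      rw [dif_pos k.2]
    · rintro ⟨c, hc⟩
      refine ⟨fun k => c k, ?_⟩
      funext θ
      rw [hc θ, ← Finset.sum_coe_sort (Finset.Icc (-(K : ℤ)) K)]
      simp only [Finset.sum_apply, Pi.smul_apply, smul_eq_mul, he]
  have hg : g ∈ (P : Set (ℝ → ℂ)) :=
    hPclosed.mem_of_tendsto (tendsto_pi_nhds.2 hlim) (Eventually.of_forall fun j => (hmem _).2 (hp j))
  exact (hmem g).1 hg

/-! ## The a.e. upgrade -/

/-- **The a.e. upgrade (band limit on generic compact supports ⇒ band limit on `⁰𝒮`, same degree)**, the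
open-binder form of `stub_orbitGenericUpgrade` (see the module docstring for the proof). -/
theorem trigPoly_of_generic (T : 𝓢((Fin N → E4), ℂ) →L[ℂ] ℂ) {W : (Fin N → E4) → ℂ}
    (hrep : ∀ F : 𝓢((Fin N → E4), ℂ), IsOffDiagonal F →
      Integrable (fun x => W x * F x) ∧ T F = ∫ x, W x * F x)
    {G : Set (Fin N → E4)} (hGo : IsOpen G) (hG0 : volume Gᶜ = 0) (hGc : G ⊆ (coincidenceLocus N E4)ᶜ)
    (K : ℕ)
    (hgen : ∀ F : 𝓢((Fin N → E4), ℂ), tsupport (F : (Fin N → E4) → ℂ) ⊆ G →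
      HasCompactSupport (F : (Fin N → E4) → ℂ) →
      ∃ c : ℤ → ℂ, ∀ θ : ℝ, T (linActMulti (planeRot (0 : Fin 3) θ) F) =
        ∑ k ∈ Finset.Icc (-(K : ℤ)) K, c k * Complex.exp (4 * (k : ℂ) * (θ : ℂ) * Complex.I))
    (F : 𝓢((Fin N → E4), ℂ)) (hF : IsOffDiagonal F) :
    ∃ c : ℤ → ℂ, ∀ θ : ℝ, T (linActMulti (planeRot (0 : Fin 3) θ) F) =
      ∑ k ∈ Finset.Icc (-(K : ℤ)) K, c k * Complex.exp (4 * (k : ℂ) * (θ : ℂ) * Complex.I) := by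
  -- `T (L·F') = ∫ (W ∘ ρ_L) F'` with an integrable integrand, for every off-diagonal `F'` and isometry `L`
  have hint : ∀ (L : E4 ≃ₗᵢ[ℝ] E4) (F' : 𝓢((Fin N → E4), ℂ)), IsOffDiagonal F' →
      Integrable (fun x => W (fun k => L (x k)) * F' x) ∧
        T (linActMulti L F') = ∫ x, W (fun k => L (x k)) * F' x := by
    intro L F' hF'
    obtain ⟨h1, h2⟩ := hrep _ (isOffDiagonal_linActMulti hF' L)
    have hcomp : (fun x => W (fun k => L (x k)) * F' x) =
        (fun y => W y * linActMulti L F' y) ∘ fun x k => L (x k) := by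
      funext x
      simp [linActMulti_apply]
    refine ⟨?_, ?_⟩
    · rw [hcomp]
      exact (measurePreserving_diag L).integrable_comp_of_integrable h1
    · rw [h2]
      exact (integral_mul_linActMulti L W F').symm
  -- a compact exhaustion `C j ↑ G` and smooth cut-offs `χ j ∈ [0,1]`, `= 1` on `C j`, supported in `G`
  set C : ℕ → Set (Fin N → E4) := fun j =>
    Metric.closedBall 0 j ∩ ⋂ y ∈ Gᶜ, {x | 1 / ((j : ℝ) + 1) ≤ dist x y} with hC
  have hCc : ∀ j, IsCompact (C j) := fun j =>
    (isCompact_closedBall _ _).inter_right (isClosed_biInter fun y _ =>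
      isClosed_le continuous_const (continuous_id.dist continuous_const))
  have hCG : ∀ j, C j ⊆ G := fun j x hx => by
    by_contra hxG
    have h := Set.mem_iInter₂.1 hx.2 x hxG
    rw [Set.mem_setOf_eq, dist_self] at h
    exact absurd h (not_le.2 (by positivity))
  have hCev : ∀ x ∈ G, ∀ᶠ j : ℕ in atTop, x ∈ C j := by
    intro x hx
    obtain ⟨δ, hδ, hδG⟩ := Metric.isOpen_iff.1 hGo x hx
    obtain ⟨n, hn⟩ := exists_nat_one_div_lt hδ
    filter_upwards [eventually_ge_atTop n, eventually_ge_atTop ⌈‖x‖⌉₊] with j hjn hjx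
    refine ⟨?_, Set.mem_iInter₂.2 fun y hy => ?_⟩
    · rw [mem_closedBall_zero_iff]
      exact (Nat.le_ceil _).trans (Nat.cast_le.2 hjx)
    · have hyx : δ ≤ dist x y := by
        by_contra hlt
        exact hy (hδG (by rw [Metric.mem_ball, dist_comm]; exact not_le.1 hlt))
      have hj : 1 / ((j : ℝ) + 1) ≤ 1 / ((n : ℝ) + 1) :=
        one_div_le_one_div_of_le (by positivity) (by exact_mod_cast Nat.succ_le_succ hjn)
      rw [Set.mem_setOf_eq]
      linarith
  choose χ hχs hχc hχG hχ1 hχ01 using fun j => exists_smooth_cutoff (hCc j) hGo (hCG j)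
  have hχ0 : ∀ x ∉ G, ∀ j, χ j x = 0 := fun x hx j =>
    image_eq_zero_of_notMem_tsupport fun h => hx (hχG j h)
  -- truncations of `F` supported in `G`
  have hcs : ∀ j, HasCompactSupport fun x : Fin N → E4 => (χ j x : ℂ) * F x := fun j =>
    ((hχc j).comp_left Complex.ofReal_zero).mul_right
  have hsm : ∀ j, ContDiff ℝ (⊤ : ℕ∞) fun x : Fin N → E4 => (χ j x : ℂ) * F x := fun j =>
    (Complex.ofRealCLM.contDiff.comp (hχs j)).mul (F.smooth _)
  set Fj : ℕ → 𝓢((Fin N → E4), ℂ) := fun j => (hcs j).toSchwartzMap (hsm j) with hFj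
  have hFj_apply : ∀ j x, Fj j x = (χ j x : ℂ) * F x := fun j x => rfl
  have hFj_supp : ∀ j, tsupport (Fj j : (Fin N → E4) → ℂ) ⊆ G := fun j =>
    (tsupport_mul_subset_left (f := fun x => (χ j x : ℂ)) (g := (F : (Fin N → E4) → ℂ))).trans
      ((tsupport_comp_subset Complex.ofReal_zero (χ j)).trans (hχG j))
  have hFj_off : ∀ j, IsOffDiagonal (Fj j) := fun j =>
    IsOffDiagonal.of_tsupport_subset ((hFj_supp j).trans hGc)
  -- pointwise convergence of the orbit functions, angle by angle, by dominated convergence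
  have hlim : ∀ θ : ℝ, Tendsto (fun j => T (linActMulti (planeRot (0 : Fin 3) θ) (Fj j))) atTop
      (𝓝 (T (linActMulti (planeRot (0 : Fin 3) θ) F))) := by
    intro θ
    set L : E4 ≃ₗᵢ[ℝ] E4 := planeRot (0 : Fin 3) θ with hL
    set D : (Fin N → E4) → ℂ := fun x => W (fun k => L (x k)) with hD
    have hDF := hint L F hF
    have hDj : ∀ j, Integrable (fun x => D x * Fj j x) ∧
        T (linActMulti L (Fj j)) = ∫ x, D x * Fj j x := fun j => hint L (Fj j) (hFj_off j)
    have hconv : Tendsto (fun j => ∫ x, D x * Fj j x) atTop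
        (𝓝 (∫ x, G.indicator (fun x => D x * F x) x)) := by
      refine tendsto_integral_of_dominated_convergence (fun x => ‖D x * F x‖)
        (fun j => (hDj j).1.aestronglyMeasurable) hDF.1.norm (fun j => ?_) ?_
      · refine Eventually.of_forall fun x => ?_
        rw [hFj_apply, norm_mul, norm_mul, norm_mul, Complex.norm_real,
          Real.norm_of_nonneg (hχ01 j x).1]
        exact mul_le_mul_of_nonneg_left (mul_le_of_le_one_left (norm_nonneg _) (hχ01 j x).2)
          (norm_nonneg _)
      · refine Eventually.of_forall fun x => ?_
        by_cases hx : x ∈ G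
        · rw [Set.indicator_of_mem hx]
          refine tendsto_const_nhds.congr' ((hCev x hx).mono fun j hj => ?_)
          show D x * F x = D x * Fj j x
          rw [hFj_apply, hχ1 j x hj, Complex.ofReal_one, one_mul]
        · rw [Set.indicator_of_notMem hx]
          have h : (fun j => D x * Fj j x) = fun _ => 0 := by
            funext j; rw [hFj_apply, hχ0 x hx j, Complex.ofReal_zero, zero_mul, mul_zero]
          rw [h]
          exact tendsto_const_nhds
    have hGind : ∫ x, G.indicator (fun x => D x * F x) x = ∫ x, D x * F x :=
      integral_congr_ae (Filter.eventuallyEq_of_mem (mem_ae_iff.2 hG0)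
        fun x hx => Set.indicator_of_mem hx _)
    rw [hDF.2, ← hGind]
    refine hconv.congr fun j => ?_
    exact (hDj j).2.symm
  exact trigPoly_of_tendsto K (fun j => hgen (Fj j) (hFj_supp j) (hcs j)) hlim

end OrbitBandlimit

/-- **Stub 3b — THE A.E. UPGRADE under the function residual.**  If a degree-`N` functional `T` is integration
against a function on `⁰𝒮` and its planar orbit functions are trigonometric polynomials of a FIXED degree `K` on
every compactly supported test function supported in an open conull set `G` avoiding the coincidence locus, then
the same holds for every `F ∈ ⁰𝒮_N` (smooth exhaustion of `G`, dominated convergence, closedness of degree-`≤ K`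
trigonometric polynomials under pointwise limits: `OrbitBandlimit.trigPoly_of_generic`). -/
theorem stub_orbitGenericUpgrade :
    open Literature.MathematicalPhysics.QuantumLattice Literature.MathematicalPhysics.AQFT
      Literature.MathematicalPhysics.QuantumFieldTheory
      Summit.QuantumFields.YangMills.Theorems.CurvatureBoostCovariance.Negative
      Summit.QuantumFields.YangMills.Theorems.NPointIsotropy.Negative in
    ∀ (N : ℕ) (T : SchwartzMap (Fin N → E4) ℂ →L[ℂ] ℂ) (W : (Fin N → E4) → ℂ),
      (∀ F : SchwartzMap (Fin N → E4) ℂ, IsOffDiagonal F →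
        MeasureTheory.Integrable (fun x => W x * F x) ∧ T F = ∫ x, W x * F x) →
      ∀ (G : Set (Fin N → E4)), IsOpen G → MeasureTheory.volume Gᶜ = 0 → G ⊆ (coincidenceLocus N E4)ᶜ →
      ∀ (K : ℕ),
        (∀ F : SchwartzMap (Fin N → E4) ℂ, tsupport (F : (Fin N → E4) → ℂ) ⊆ G →
          HasCompactSupport (F : (Fin N → E4) → ℂ) →
          ∃ c : ℤ → ℂ, ∀ θ : ℝ, T (linActMulti (planeRot (0 : Fin 3) θ) F) =
            ∑ k ∈ Finset.Icc (-(K : ℤ)) K, c k * Complex.exp (4 * (k : ℂ) * (θ : ℂ) * Complex.I)) →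
        ∀ (F : SchwartzMap (Fin N → E4) ℂ), IsOffDiagonal F →
          ∃ c : ℤ → ℂ, ∀ θ : ℝ, T (linActMulti (planeRot (0 : Fin 3) θ) F) =
            ∑ k ∈ Finset.Icc (-(K : ℤ)) K, c k * Complex.exp (4 * (k : ℂ) * (θ : ℂ) * Complex.I) := by
  intro N T W hrep G hGo hG0 hGc K hgen F hF
  exact OrbitBandlimit.trigPoly_of_generic T hrep hGo hG0 hGc K hgen F hF

end Summit.QuantumFields.YangMills.Theorems.CurvatureBoostCovariance.BoostsInheritMirrors

end
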